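import Literature.NumberTheory.Weil1964.ArchDualPairNoPositiveCharacter
import HarnessLib

/-!
# `U(diag x)(ℂ) = U(diag(−x))(ℂ)`: the «no positive character» input for BOTH orientations of a real rank `≤ 1` sign profile

Topic `NumberTheory/Weil1964`; namespace `Literature.NumberTheory.Weil1964`.  KERNEL MATHEMATICS ONLY: proved theorems;
no definition, no `def … : Prop` record, no axiom, no proof hole.

`ArchDualPairNoPositiveCharacter` §4 proves «every continuous positive multiplicative function on `U(diag x)(ℂ)` is `1`»
under the sign profile «`x` has at most one negative entry, or is negative everywhere» (`U(p,q)` with `q ≤ 1`, or `U(0,q)`),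
and transports it to the archimedean group `U(diag(t₀) ⊗ 1)(E ⊗ ℝ)` place by place
(`UnitaryGroup.mulPos_eq_one_arch_diagonal`).  The unitary group of a form does not see the sign of the form:
`U(−H) = U(H)` (`ArchFollandDualPair.unitaryGroupOfForm_smul_eq` with the scalar `−1`), so the MIRRORED profile
«at most one positive entry, or positive everywhere» (`U(p,q)` with `p ≤ 1`) is covered as well — this is the orientation
freedom of the sign facts through a complex embedding («all but one of the `re ι₁(dᵢ)` have a common strict sign») in which
the CM theta pin states its signature hypothesis (`ArchDualPairThetaMajorants.hasThetaMajorants_cmPairSplitting_of_signs`):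

* `diagonal_map_ofRealHom_neg` — `diag(−x) = (−1 : ℝ) • diag(x)` over `ℂ`;
* `unitaryGroupOfForm_realDiagonal_neg` — `U(diag(−x))(ℂ) = U(diag x)(ℂ)` as subgroups of `GL_N(ℂ)`;
* `mulPos_eq_one_unitaryGroupOfForm_realDiagonal_symm` — the property for `diag(x)` when `x` OR `−x` has the profile of §4;
* `UnitaryGroup.mulPos_eq_one_archLocal_diagonal_symm`, **`UnitaryGroup.mulPos_eq_one_arch_diagonal_symm`** — the same
  upgrade of the per-place / archimedean statements for `J = diag(t₀) ⊗ 1` (profile of `σ_v(t₀)` or of `−σ_v(t₀)` at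
  every complex place).

## References

* [PlatonovRapinchuk1994] V. Platonov, A. Rapinchuk, *Algebraic Groups and Number Theory*, Academic Press (1994), §2.3
  (hermitian forms over `ℂ/ℝ`; `U(H)` depends on `H` up to a scalar).
* [Knapp2002] A. W. Knapp, *Lie Groups Beyond an Introduction*, 2nd ed., Birkhäuser (2002), Thm 7.39 (`G = K A K`).
* [Folland1989] G. B. Folland, *Harmonic Analysis in Phase Space*, Princeton UP (1989), §4.2, the Schur remark p. 156
  (where the input is consumed).

## Provenance

LEAN-IN-TREE rule (2026-08-18), pub-hodgecm model-construction sub-cell, discharge seat mc-discharge-3 (ticket D-3, (J-arch)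
(w2′) = BINDER-OWNERS §1a rows 10/16/17 sub-item (c4), orientation upgrade for the CM pin's signature hypothesis `h₁V`).
Nothing here is a claim of the manuscripts adjudicated by that cell.
-/

noncomputable section

open scoped Matrix ComplexConjugate
open Complex NumberField NumberField.InfinitePlace NumberField.mixedEmbedding
open Literature.NumberTheory.Automorphic Literature.NumberTheory.Automorphic.UnitaryGroup
open Literature.RepresentationTheory.KonnoKonno2007 Literature.RepresentationTheory.KonnoKonno2007.RealDualPair

namespace Literature.NumberTheory.Weil1964

/-! ## §1 `U(diag(−x)) = U(diag x)` -/

section Diagonal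

/-- `diag(−x) = (−1 : ℝ) • diag(x)` as complex matrices. [folklore] -/
theorem diagonal_map_ofRealHom_neg {N : ℕ} (x : Fin N → ℝ) :
    (Matrix.diagonal (-x)).map Complex.ofRealHom = (((-1 : ℝ) : ℂ)) • (Matrix.diagonal x).map Complex.ofRealHom := by
  ext i j
  by_cases h : i = j
  · subst h
    simp [Matrix.map_apply, Matrix.diagonal_apply_eq]
  · simp [Matrix.map_apply, Matrix.diagonal_apply_ne _ h]

/-- **`U(diag(−x))(ℂ) = U(diag x)(ℂ)`** — the unitary group of a form does not see the sign of the form.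
[cite: PlatonovRapinchuk1994, §2.3] -/
theorem unitaryGroupOfForm_realDiagonal_neg {N : ℕ} (x : Fin N → ℝ) :
    unitaryGroupOfForm (starRingEnd ℂ) ((Matrix.diagonal (-x)).map Complex.ofRealHom) =
      unitaryGroupOfForm (starRingEnd ℂ) ((Matrix.diagonal x).map Complex.ofRealHom) := by
  rw [diagonal_map_ofRealHom_neg, unitaryGroupOfForm_smul_eq _ (neg_ne_zero.2 one_ne_zero)]

/-- **A real diagonal form `diag(x)` such that `x` OR `−x` has at most one negative entry or is negative everywhere**
(`U(p,q)` with `min(p,q) ≤ 1`, either orientation): `U(diag x)(ℂ)` carries no non-trivial continuous positive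
multiplicative function. [cite: PlatonovRapinchuk1994, §2.3; Knapp2002, Thm 7.39] -/
theorem mulPos_eq_one_unitaryGroupOfForm_realDiagonal_symm {N : ℕ} (x : Fin N → ℝ) (hx : ∀ i, x i ≠ 0)
    (hprof : ((∃ i₀, ∀ i, i ≠ i₀ → 0 < x i) ∨ ∀ i, x i < 0) ∨ ((∃ i₀, ∀ i, i ≠ i₀ → x i < 0) ∨ ∀ i, 0 < x i))
    (m : unitaryGroupOfForm (starRingEnd ℂ) ((Matrix.diagonal x).map Complex.ofRealHom) → ℝ)
    (hm : ∀ g h, m (g * h) = m g * m h) (hpos : ∀ g, 0 < m g) (hcont : Continuous m)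
    (g : unitaryGroupOfForm (starRingEnd ℂ) ((Matrix.diagonal x).map Complex.ofRealHom)) : m g = 1 := by
  rcases hprof with hprof | hprof
  · exact mulPos_eq_one_unitaryGroupOfForm_realDiagonal x hx hprof m hm hpos hcont g
  · -- the mirrored profile is the profile of `−x`; transport along `U(diag(−x)) = U(diag x)`
    have hprof' : (∃ i₀, ∀ i, i ≠ i₀ → 0 < (-x) i) ∨ ∀ i, (-x) i < 0 :=
      hprof.imp (fun ⟨i₀, h⟩ => ⟨i₀, fun i hi => by rw [Pi.neg_apply, neg_pos]; exact h i hi⟩) fun h i => by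
        rw [Pi.neg_apply, neg_lt_zero]; exact h i
    have heq := unitaryGroupOfForm_realDiagonal_neg x
    exact mulPos_eq_one_of_surjective (MulEquiv.subgroupCongr heq).toMonoidHom (continuous_subgroupCongr heq)
      (MulEquiv.subgroupCongr heq).surjective
      (mulPos_eq_one_unitaryGroupOfForm_realDiagonal (-x) (fun i => neg_ne_zero.2 (hx i)) hprof') m hm hpos hcont g

variable (F E : Type) [Field F] [NumberField F] [Field E] [NumberField E] [Algebra F E]
  (c : E ≃ₐ[F] E) (N : ℕ) (J : Matrix (Fin N) (Fin N) E)

/-- **Per place, diagonal form `J = diag(t₀) ⊗ 1`, either orientation**: at a complex place `w` fixed by `c ≠ 1`, if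
`σ_v t₀` OR `−σ_v t₀` has at most one negative entry or is negative everywhere then `U(σ_w J)(ℂ)` carries no non-trivial
continuous positive multiplicative function. [cite: PlatonovRapinchuk1994, §2.3; Knapp2002, Thm 7.39] -/
theorem UnitaryGroup.mulPos_eq_one_archLocal_diagonal_symm (w : {w : InfinitePlace E // IsComplex w})
    (hw : c • w.1 = w.1) (hc : c ≠ 1) (t₀ : Fin N → F) (hJ : J = (Matrix.diagonal t₀).map (algebraMap F E))
    (ht₀ : ∀ i, t₀ i ≠ 0)
    (hprof : ((∃ i₀, ∀ i, i ≠ i₀ → 0 < UnitaryGroup.realPlaceMap F E c w hw hc (t₀ i)) ∨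
        ∀ i, UnitaryGroup.realPlaceMap F E c w hw hc (t₀ i) < 0) ∨
      ((∃ i₀, ∀ i, i ≠ i₀ → UnitaryGroup.realPlaceMap F E c w hw hc (t₀ i) < 0) ∨
        ∀ i, 0 < UnitaryGroup.realPlaceMap F E c w hw hc (t₀ i)))
    (m : archLocal E N J w → ℝ) (hm : ∀ g h, m (g * h) = m g * m h) (hpos : ∀ g, 0 < m g) (hcont : Continuous m)
    (g : archLocal E N J w) : m g = 1 := by
  have hJw : J.map w.1.embedding =
      (Matrix.diagonal fun i => UnitaryGroup.realPlaceMap F E c w hw hc (t₀ i)).map Complex.ofRealHom := by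
    rw [UnitaryGroup.archLocalForm_eq_map F E c N w hw hc (Matrix.diagonal t₀) hJ, Matrix.diagonal_map (map_zero _)]
  have heq : unitaryGroupOfForm (starRingEnd ℂ)
      ((Matrix.diagonal fun i => UnitaryGroup.realPlaceMap F E c w hw hc (t₀ i)).map Complex.ofRealHom) =
        archLocal E N J w := by
    rw [← hJw]; rfl
  exact mulPos_eq_one_of_surjective (MulEquiv.subgroupCongr heq).toMonoidHom (continuous_subgroupCongr heq)
    (MulEquiv.subgroupCongr heq).surjective
    (mulPos_eq_one_unitaryGroupOfForm_realDiagonal_symm _ (fun i => (map_ne_zero _).2 (ht₀ i)) hprof) m hm hpos hcont g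

/-- **`U(diag(t₀) ⊗ 1)(E ⊗ ℝ)` of place-wise real rank `≤ 1`, either orientation at each place** (at every complex place
`w`, `σ_v t₀` or `−σ_v t₀` has at most one negative entry or is negative everywhere; `c ≠ 1` fixes every infinite place):
no non-trivial continuous positive multiplicative function. [cite: PlatonovRapinchuk1994, §2.3; Knapp2002, Thm 7.39] -/
theorem UnitaryGroup.mulPos_eq_one_arch_diagonal_symm (hc : c ≠ 1) (hfix : ∀ w : InfinitePlace E, c • w = w)
    (t₀ : Fin N → F) (hJ : J = (Matrix.diagonal t₀).map (algebraMap F E)) (ht₀ : ∀ i, t₀ i ≠ 0)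
    (hprof : ∀ w : {w : InfinitePlace E // IsComplex w},
      ((∃ i₀, ∀ i, i ≠ i₀ → 0 < UnitaryGroup.realPlaceMap F E c w (hfix w.1) hc (t₀ i)) ∨
          ∀ i, UnitaryGroup.realPlaceMap F E c w (hfix w.1) hc (t₀ i) < 0) ∨
        ((∃ i₀, ∀ i, i ≠ i₀ → UnitaryGroup.realPlaceMap F E c w (hfix w.1) hc (t₀ i) < 0) ∨
          ∀ i, 0 < UnitaryGroup.realPlaceMap F E c w (hfix w.1) hc (t₀ i)))
    (m : arch F E c N J → ℝ) (hm : ∀ g h, m (g * h) = m g * m h) (hpos : ∀ g, 0 < m g) (hcont : Continuous m)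
    (g : arch F E c N J) : m g = 1 :=
  UnitaryGroup.mulPos_eq_one_arch F E c N J hc hfix
    (fun w => UnitaryGroup.mulPos_eq_one_archLocal_diagonal_symm F E c N J w (hfix w.1) hc t₀ hJ ht₀ (hprof w)) m hm
    hpos hcont g

end Diagonal

end Literature.NumberTheory.Weil1964
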